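import Mathlib
import Literature.Computability.AlgebraicComplexity.NewtonPolygonTauProductBounds
import Summits.ValiantsHypothesis.ValiantsHypothesis.Theorems.NewtonUnitEquationsDissociatedUniformTotalsLawBohrBox
import Summits.ValiantsHypothesis.ValiantsHypothesis.Theorems.NewtonUnitEquationsDissociatedUniformTotalsLawGridDominanceKeyed
import HarnessLib

/-!
# Crux `NewtonUnitEquations.DissociatedUniform` (stmt-ValiantsHypothesis-5905), `n = 3` totals law of model (Q**):
# DIGIT BOXES AND TWO-STEP BOHR SETS ARE LOG-FREE UNDER THE KEYED GRID-DOMINANCE RUNG (conditional rung link)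

Memo `Cruxes/DissociatedUniform/NOTES-t1g18.md` §3; companion of `…TotalsLawGridDominanceKeyed` (`GridDominanceKeyBound C ⇒` the box
stratum of `ℤ/q₁ × ℤ/q₂` is log-free).  The same rung link for the `ℤ/q` strata of `…TotalsLawBohrBox`: the box corners
`x ↦ (boxCorner/N, boxCorner mod N)` are injective (`boxCorner_injective`), so `BoxWin.ncard_extremePoints_boxWindows_le_of_keyBound`
applies to the digit-box window decomposition `unionPts_digitBox_eq`:
* `unionVert_digitBox_le_of_keyBound` — fitting digit boxes (`1 ≤ m₂ ≤ N`, `m₁N ≤ q`): `#vert conv U_s(Z) ≤ 24C·q` (vs `208Kq`);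
* `unionVert_digitBox_le_wrap_of_keyBound` — wrapping digit boxes: `≤ 4C(4q + 2m₁N)` (vs `16K(5q + 2m₁N)`);
* `unionVert_bohrTwo_le_of_keyBound` — two-step Bohr sets `{t + i d₁ + j d₂}` with `d₂` a unit: the same with `N = (d₁d₂⁻¹).val`.
Honest label: conditional stratum theorems; `GridDominanceKeyBound` is NOT proved; `UnionTotalsLaw C`, `TriWordsBound C`, `TotalsLawThree C`
remain OPEN and are asserted nowhere; nothing here bears on VP ≠ VNP. [folklore]
-/

set_option linter.dupNamespace false -- `ValiantsHypothesis.ValiantsHypothesis` (summit = problem) in every name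

open Finset Matrix
open scoped Pointwise

namespace Summit.ValiantsHypothesis.ValiantsHypothesis.Theorems.NewtonUnitEquationsDissociatedUniform

namespace TotalsLaw

open Literature.Computability.AlgebraicComplexity.KPTT.PlanarMinkowski

/-! ### Digit boxes and two-step Bohr sets under the keyed rung -/

section Digit

variable {q : ℕ} [NeZero q]

/-- Box corners of digit boxes are injective in the group element. [folklore] -/
theorem boxCorner_injective (t N m₁ m₂ : ℕ) (s : ZMod q) : Function.Injective (boxCorner t N m₁ m₂ s) := by
  intro x y h
  unfold boxCorner at h
  have h1 := ZMod.val_injective q h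
  exact sub_right_injective (sub_left_injective h1)

/-- **DIGIT BOXES ARE LOG-FREE UNDER THE KEYED RUNG:** for a fitting digit box (`1 ≤ m₂ ≤ N`, `1 ≤ m₁`, `m₁N ≤ q`) and all `a b`,
`GridDominanceKeyBound C ⇒ #vert conv U_s(Z) ≤ 24C·q` (vs. `208Kq`, `K = O(log q)`, unconditionally in `…TotalsLawBohrBox`). [folklore] -/
theorem unionVert_digitBox_le_of_keyBound {C : ℕ} (hC : GridDominanceKeyBound C) (a b : ZMod q → (Fin 2 → ℝ)) (t N m₁ m₂ : ℕ)
    (hm₁ : 0 < m₁) (hm₂ : 0 < m₂) (hm₂N : m₂ ≤ N) (hfit : m₁ * N ≤ q) (s : ZMod q) :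
    unionVert a b (digitBox q t N m₁ m₂ : Set (ZMod q)) s ≤ 24 * C * q := by
  have hN : 0 < N := lt_of_lt_of_le hm₂ hm₂N
  have hq : 0 < q := Nat.pos_of_ne_zero (NeZero.ne q)
  unfold unionVert
  rw [unionPts_digitBox_eq a b t N m₁ m₂ s]
  have h := BoxWin.ncard_extremePoints_boxWindows_le_of_keyBound hC (fun n : ℕ × ℕ => b ((n.1 * N + n.2 : ℕ) : ZMod q)) a
    (fun x : ZMod q => boxCorner t N m₁ m₂ s x / N) (fun x => boxCorner t N m₁ m₂ s x % N) hm₁ hm₂ (q / N + 1) N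
    (fun x => Nat.lt_succ_of_le (Nat.div_le_div_right (boxCorner_lt t N m₁ m₂ s x).le))
    (fun x => Nat.mod_lt _ hN)
    (fun x x' h1 h2 => boxCorner_injective t N m₁ m₂ s (by
      rw [← Nat.div_add_mod (boxCorner t N m₁ m₂ s x) N, ← Nat.div_add_mod (boxCorner t N m₁ m₂ s x') N, h1, h2]))
  refine h.trans ?_
  have h1 : m₁ * ((q / N + 1) / m₁ + 1) ≤ q / N + 1 + m₁ := by
    have := Nat.mul_div_le (q / N + 1) m₁; rw [Nat.mul_comm] at this; nlinarith
  have h2 : m₂ * (N / m₂ + 1) ≤ 2 * N := by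
    have := Nat.mul_div_le N m₂; rw [Nat.mul_comm] at this; nlinarith
  have h3 : (q / N + 1 + m₁) * N ≤ 3 * q := by
    have e1 : q / N * N ≤ q := Nat.div_mul_le_self q N
    have e2 : N ≤ q := le_trans (by nlinarith : N ≤ m₁ * N) hfit
    nlinarith
  have harea : m₁ * m₂ * (((q / N + 1) / m₁ + 1) * (N / m₂ + 1)) ≤ 6 * q := by
    calc m₁ * m₂ * (((q / N + 1) / m₁ + 1) * (N / m₂ + 1))
        = (m₁ * ((q / N + 1) / m₁ + 1)) * (m₂ * (N / m₂ + 1)) := by ring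
      _ ≤ (q / N + 1 + m₁) * (2 * N) := Nat.mul_le_mul h1 h2
      _ = 2 * ((q / N + 1 + m₁) * N) := by ring
      _ ≤ 2 * (3 * q) := Nat.mul_le_mul_left 2 h3
      _ = 6 * q := by ring
  calc 4 * C * (m₁ * m₂) * (((q / N + 1) / m₁ + 1) * (N / m₂ + 1))
      = 4 * C * (m₁ * m₂ * (((q / N + 1) / m₁ + 1) * (N / m₂ + 1))) := by ring
    _ ≤ 4 * C * (6 * q) := Nat.mul_le_mul_left _ harea
    _ = 24 * C * q := by ring

/-- **Wrapping digit boxes under the keyed rung** (`1 ≤ m₂ ≤ N ≤ q`, `1 ≤ m₁`, no fitting hypothesis):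
`GridDominanceKeyBound C ⇒ #vert conv U_s(Z) ≤ 4C·(4q + 2m₁N)`. [folklore] -/
theorem unionVert_digitBox_le_wrap_of_keyBound {C : ℕ} (hC : GridDominanceKeyBound C) (a b : ZMod q → (Fin 2 → ℝ))
    (t N m₁ m₂ : ℕ) (hm₁ : 0 < m₁) (hm₂ : 0 < m₂) (hm₂N : m₂ ≤ N) (hNq : N ≤ q) (s : ZMod q) :
    unionVert a b (digitBox q t N m₁ m₂ : Set (ZMod q)) s ≤ 4 * C * (4 * q + 2 * (m₁ * N)) := by
  have hN : 0 < N := lt_of_lt_of_le hm₂ hm₂N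
  unfold unionVert
  rw [unionPts_digitBox_eq a b t N m₁ m₂ s]
  have h := BoxWin.ncard_extremePoints_boxWindows_le_of_keyBound hC (fun n : ℕ × ℕ => b ((n.1 * N + n.2 : ℕ) : ZMod q)) a
    (fun x : ZMod q => boxCorner t N m₁ m₂ s x / N) (fun x => boxCorner t N m₁ m₂ s x % N) hm₁ hm₂ (q / N + 1) N
    (fun x => Nat.lt_succ_of_le (Nat.div_le_div_right (boxCorner_lt t N m₁ m₂ s x).le))
    (fun x => Nat.mod_lt _ hN)
    (fun x x' h1 h2 => boxCorner_injective t N m₁ m₂ s (by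
      rw [← Nat.div_add_mod (boxCorner t N m₁ m₂ s x) N, ← Nat.div_add_mod (boxCorner t N m₁ m₂ s x') N, h1, h2]))
  refine h.trans ?_
  have h1 : m₁ * ((q / N + 1) / m₁ + 1) ≤ q / N + 1 + m₁ := by
    have := Nat.mul_div_le (q / N + 1) m₁; rw [Nat.mul_comm] at this; nlinarith
  have h2 : m₂ * (N / m₂ + 1) ≤ 2 * N := by
    have := Nat.mul_div_le N m₂; rw [Nat.mul_comm] at this; nlinarith
  have h3 : (q / N + 1 + m₁) * (2 * N) ≤ 4 * q + 2 * (m₁ * N) := by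
    have e1 : q / N * N ≤ q := Nat.div_mul_le_self q N
    nlinarith
  have harea : m₁ * m₂ * (((q / N + 1) / m₁ + 1) * (N / m₂ + 1)) ≤ 4 * q + 2 * (m₁ * N) := by
    calc m₁ * m₂ * (((q / N + 1) / m₁ + 1) * (N / m₂ + 1))
        = (m₁ * ((q / N + 1) / m₁ + 1)) * (m₂ * (N / m₂ + 1)) := by ring
      _ ≤ (q / N + 1 + m₁) * (2 * N) := Nat.mul_le_mul h1 h2
      _ ≤ 4 * q + 2 * (m₁ * N) := h3
  calc 4 * C * (m₁ * m₂) * (((q / N + 1) / m₁ + 1) * (N / m₂ + 1))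
      = 4 * C * (m₁ * m₂ * (((q / N + 1) / m₁ + 1) * (N / m₂ + 1))) := by ring
    _ ≤ 4 * C * (4 * q + 2 * (m₁ * N)) := Nat.mul_le_mul_left _ harea

/-- **Two-step Bohr sets `{t + i d₁ + j d₂}` (`d₂` a unit) under the keyed rung:** `≤ 4C·(4q + 2m₁N)` with `N = (d₁ d₂⁻¹).val`,
`1 ≤ m₂ ≤ N`, `1 ≤ m₁` (relabel by `z ↦ z d₂`, `…UnionCosets.unionVert_comp_addEquiv`). [folklore] -/
theorem unionVert_bohrTwo_le_of_keyBound {C : ℕ} (hC : GridDominanceKeyBound C) (a b : ZMod q → (Fin 2 → ℝ)) (t d₁ : ZMod q)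
    (d₂ : (ZMod q)ˣ) (m₁ m₂ : ℕ) (hm₁ : 0 < m₁) (hm₂ : 0 < m₂) (hm₂N : m₂ ≤ (d₁ * (↑d₂⁻¹ : ZMod q)).val) (s : ZMod q) :
    unionVert a b (bohrTwo q t d₁ (d₂ : ZMod q) m₁ m₂ : Set (ZMod q)) s ≤ 4 * C * (4 * q + 2 * (m₁ * (d₁ * (↑d₂⁻¹ : ZMod q)).val)) := by
  rw [bohrTwo_eq_image_digitBox t d₁ d₂ m₁ m₂]
  have h := unionVert_comp_addEquiv a b (AddAut.mulRight d₂)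
    (digitBox q (t * (↑d₂⁻¹ : ZMod q)).val ((d₁ * (↑d₂⁻¹ : ZMod q)).val) m₁ m₂ : Set (ZMod q)) ((AddAut.mulRight d₂).symm s)
  rw [AddEquiv.apply_symm_apply] at h
  rw [← h]
  exact unionVert_digitBox_le_wrap_of_keyBound hC _ _ _ _ m₁ m₂ hm₁ hm₂ hm₂N (ZMod.val_lt _).le _

end Digit

end TotalsLaw

end Summit.ValiantsHypothesis.ValiantsHypothesis.Theorems.NewtonUnitEquationsDissociatedUniform
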